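import Summits.ResolutionOfSingularities.ResolutionOfSingularities.Theorems.PurelyInseparableDim4ResConeLayerBirths
import Summits.ResolutionOfSingularities.ResolutionOfSingularities.Theorems.PurelyInseparableDim4ResConeShadeOneStep
import HarnessLib
import HarnessLib.Audit.Tags

/-!
# Purely inseparable four-folds — the PURE-CORNER TRANSPORT of residual exponents: at a point step read at the
# chart origin the residual monomials move by Hironaka's corner map `f ↦ f.update j (|f| − d)`, with no births
# (idea-4 CARD I-4-8 §A «NO BIRTHS, NO DEATHS outside Q»; K2(p) lane, SLICE C (C4), file-holder res-dim4-p-5 g3)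

[OURS · counted 0 · cell `res-dim4-pi` · K2(p) lane (desk WORDS #78 (d), #80 (d)) · seat res-dim4-p-5 g3.]
Nothing here proves K2(p), `NoIsolatedTrap p p` or resolution of singularities in dimension ≥ 4 /
characteristic `p`.

Setting (`…ResCone*`, `…ResConeLayerBirths` p-12 g3): a presented state `s = (F, r, exc)` with `x^r ∣ F`,
`ord₀ F = o ≥ q`, residual degree `d = o − |r|`, and the point step at the chart ORIGIN of the `x_j`-chart
(`b = 0`, a PURE CORNER), new state `s′ = CentreBlowup.step q univ j 0 s`.  Residual exponents: `f = e − r` for a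
monomial `x^e` of `F`.

* §1 `step_zero_F`, `step_zero_r` (`r′ = r.update j (o − q)`), `coeff_step_zero_chartExponent` — at a pure
  corner the sheared polynomial of `…LayerBirths` is `F` itself: with p-7 g2's `…ShadeOneStep`
  (`exists_of_mem_support_step_zero`, `chartExponent_mem_support_step_zero`, imported) the monomials of `F′` are
  exactly the chart images `x^{e′}`, `e′ = chartExponent e`, of the monomials of `F` not deleted by the cleaning
  (NO BIRTHS);
* §2 **`chartExponent_eq_step_zero_r_add`** — the RESIDUAL LAW: `e′ = r′ + f′` with
  `f′ = f.update j (|f| − d)` (Hironaka's corner map on the residual exponent; the `d`-controlled transform of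
  `G = F / x^r`), and its unpacking `sub_step_zero_r_eq` for monomials of `F′`;
* §3 passive letters: for the polyhedron letters `a ≠ a′` and the PASSIVE set `P = univ ∖ {a, a′}`,
  `degree_eq_apply_add_apply_add_degIn` (`|f| = f_a + f_{a′} + |f|_P`), `degIn_update_of_not_mem` (a move in
  chart `j ∉ P` keeps `|f|_P`, hence the LEVEL `n = d − |f|_P` of the generating point `(f_a, f_{a′})/n`), and
  **`update_apply_chart` / `update_apply_other`**: in chart `a` the pair `(f_a, f_{a′})` becomes
  `(f_a + f_{a′} − n, f_{a′})` — the numerator form of `T_a (α, β) = (α + β − 1, β)` used by `…WindowGame`.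
[cite: CossartJannsenSaito2020, Lemma 13.2, Lemma 13.4 (the maps T_a, T_b = Hironaka 1967)]
bears_on: LADDER-RESOLUTION:D157-DOOR2 (res-dim4-pi · K2(p) = `RidgeBudget.NoAboveFloorTrap p p` · slice C).
Supports stmt-ResolutionOfSingularities-16155 (helper).
-/

set_option linter.dupNamespace false -- mandated namespace of this single-conjunct summit

noncomputable section

namespace Summit.ResolutionOfSingularities.ResolutionOfSingularities.Theorems.PIDim4

namespace ResCone

open MvPolynomial Finset
open Literature.AlgebraicGeometry.Resolution
open Literature.AlgebraicGeometry.Resolution.CentreBlowup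
open Literature.AlgebraicGeometry.Resolution.Hauser2010
open Literature.AlgebraicGeometry.Resolution.HauserPerlega2019

variable {K : Type} [Field K]

/-! ## 1. The pure corner: polynomial, boundary, monomials -/

section Corner

variable [DecidableEq K]

/-- At a pure corner (`b = 0`) the new polynomial is the cleaned chart-origin transform of `F` itself.
[cite: Hauser2010, §§F–G] -/
theorem step_zero_F (q : ℕ) (j : Fin 4) (s : State K) (hq : (q : ℕ∞) ≤ ordAlong Finset.univ s.F) :
    (CentreBlowup.step q Finset.univ j 0 s).F = deletePthPowers q (chartTransform q Finset.univ j s.F) := by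
  rw [step_F_eq_deletePthPowers_chartTransform_shear q j (show (0 : Fin 4 → K) j = 0 from rfl) s hq,
    shear_zero]

/-- At a pure corner every old component is kept: `r′ = r.update j (o − q)`. [cite: HauserPerlega2019PRIMS, §2] -/
theorem step_zero_r (q : ℕ) (j : Fin 4) (s : State K) {o : ℕ} (ho : ordZero s.F = o)
    (hr : ∀ d ∈ s.F.support, s.r ≤ d) :
    (CentreBlowup.step q Finset.univ j 0 s).r = s.r.update j (o - q) := by
  rw [step_r_univ q j (show (0 : Fin 4 → K) j = 0 from rfl) s ho hr]
  congr 1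
  ext i
  rw [Finsupp.filter_apply, if_pos (Pi.zero_apply i)]

/-- **No births, forward**: the coefficient of the chart image `x^{e′}` in `F′` is the coefficient of `x^e` in
`F`, unless the cleaning deletes it. [folklore] -/
theorem coeff_step_zero_chartExponent (q : ℕ) (j : Fin 4) (s : State K)
    (hq : (q : ℕ∞) ≤ ordAlong Finset.univ s.F) {e : Fin 4 →₀ ℕ} (he : q ≤ e.degree) :
    coeff (chartExponent q Finset.univ j e) (CentreBlowup.step q Finset.univ j 0 s).F =
      if IsPthPowerExponent q (chartExponent q Finset.univ j e) then 0 else coeff e s.F := by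
  rw [coeff_step_F_chartExponent q j (show (0 : Fin 4 → K) j = 0 from rfl) s hq he, shear_zero]

-- NO BIRTHS, backward (`exists_of_mem_support_step_zero`) and the survival of a non-deleted monomial
-- (`chartExponent_mem_support_step_zero`) are p-7 g2's, `…ResConeShadeOneStep` (imported, not restated).

end Corner

/-! ## 2. The residual law `f′ = f.update j (|f| − d)` -/

/-- Degree of a residual exponent: `|e − r| + |r| = |e|` for `r ≤ e`. [folklore] -/
theorem degree_sub_add_degree {r e : Fin 4 →₀ ℕ} (h : r ≤ e) : (e - r).degree + r.degree = e.degree := by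
  rw [← map_add, tsub_add_cancel_of_le h]

/-- Monomials of `F` have degree `≥ ord₀ F`. [folklore] -/
theorem le_degree_of_mem_support_of_ordZero {F : MvPolynomial (Fin 4) K} {o : ℕ} (ho : ordZero F = o)
    {e : Fin 4 →₀ ℕ} (he : e ∈ F.support) : o ≤ e.degree := by
  have h := Literature.Barriers.ResolutionOfSingularities.ordZero_le_of_coeff_ne_zero _ _
    (MvPolynomial.mem_support_iff.mp he)
  rw [ho] at h
  exact_mod_cast h

/-- **THE RESIDUAL LAW AT A PURE CORNER**: for a monomial `x^e` of `F` (`x^r ∣ F`, `ord₀ F = o ≥ q`), the chart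
image is `e′ = r′ + f′` with `r′ = r.update j (o − q)` and `f′ = f.update j (|f| − d)`, `f = e − r`, `d = o − |r|` —
Hironaka's corner map on the residual exponent. [cite: CossartJannsenSaito2020, Lemma 13.2] -/
theorem chartExponent_eq_step_zero_r_add [DecidableEq K] (q : ℕ) (j : Fin 4) (s : State K) {o : ℕ}
    (ho : ordZero s.F = o) (hr : ∀ d ∈ s.F.support, s.r ≤ d) (hqo : q ≤ o) {e : Fin 4 →₀ ℕ}
    (he : e ∈ s.F.support) :
    chartExponent q Finset.univ j e = (CentreBlowup.step q Finset.univ j 0 s).r +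
      (e - s.r).update j ((e - s.r).degree - (o - s.r.degree)) := by
  have hre : s.r ≤ e := hr e he
  have hdeg := degree_sub_add_degree hre
  have hoe := le_degree_of_mem_support_of_ordZero ho he
  have hro := degree_r_le ho hr
  rw [step_zero_r q j s ho hr]
  ext i
  by_cases hij : i = j
  · subst hij
    rw [chartExponent_univ_apply_self, Finsupp.add_apply, Finsupp.update_apply, if_pos rfl,
      Finsupp.update_apply, if_pos rfl]
    omega
  · rw [chartExponent_apply_of_ne q Finset.univ hij, Finsupp.add_apply, Finsupp.update_apply, if_neg hij,
      Finsupp.update_apply, if_neg hij, Finsupp.tsub_apply, add_tsub_cancel_of_le (hre i)]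

/-- The residual law read on a monomial `x^{E}` of `F′`: `E − r′ = (e − r).update j (|e − r| − d)` for its
(unique) source `x^e`. [cite: CossartJannsenSaito2020, Lemma 13.2] -/
theorem sub_step_zero_r_eq [DecidableEq K] (q : ℕ) (j : Fin 4) (s : State K) {o : ℕ}
    (ho : ordZero s.F = o) (hr : ∀ d ∈ s.F.support, s.r ≤ d) (hqo : q ≤ o) {e : Fin 4 →₀ ℕ}
    (he : e ∈ s.F.support) :
    chartExponent q Finset.univ j e - (CentreBlowup.step q Finset.univ j 0 s).r =
      (e - s.r).update j ((e - s.r).degree - (o - s.r.degree)) := by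
  rw [chartExponent_eq_step_zero_r_add q j s ho hr hqo he, add_tsub_cancel_left]

/-- `x^{r′} ∣ x^{e′}` for every chart image (the new boundary divides the new polynomial monomialwise).
[folklore] -/
theorem step_zero_r_le_chartExponent [DecidableEq K] (q : ℕ) (j : Fin 4) (s : State K) {o : ℕ}
    (ho : ordZero s.F = o) (hr : ∀ d ∈ s.F.support, s.r ≤ d) (hqo : q ≤ o) {e : Fin 4 →₀ ℕ}
    (he : e ∈ s.F.support) :
    (CentreBlowup.step q Finset.univ j 0 s).r ≤ chartExponent q Finset.univ j e := by
  rw [chartExponent_eq_step_zero_r_add q j s ho hr hqo he]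
  exact le_self_add

/-! ## 3. Passive letters, the level, and the corner map on the active pair -/

/-- `|f| = f_a + f_{a′} + Σ_{i ∉ {a, a′}} f_i` for `a ≠ a′`. [folklore] -/
theorem degree_eq_apply_add_apply_add_degIn {a a' : Fin 4} (h : a ≠ a') (f : Fin 4 →₀ ℕ) :
    f.degree = f a + f a' + degIn ((Finset.univ.erase a).erase a') f := by
  rw [← degIn_univ, degIn, degIn, ← Finset.add_sum_erase _ _ (Finset.mem_univ a),
    ← Finset.add_sum_erase _ _ (Finset.mem_erase.mpr ⟨h.symm, Finset.mem_univ a'⟩), add_assoc]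

/-- A move in a chart `j ∉ P` keeps the passive degree `|f|_P`. [folklore] -/
theorem degIn_update_of_not_mem {P : Finset (Fin 4)} {j : Fin 4} (hj : j ∉ P) (f : Fin 4 →₀ ℕ) (v : ℕ) :
    degIn P (f.update j v) = degIn P f := by
  unfold degIn
  refine Finset.sum_congr rfl fun i hi => ?_
  rw [Finsupp.update_apply, if_neg]
  rintro rfl
  exact hj hi

/-- The chart letters are not passive. [folklore] -/
theorem not_mem_passive_left (a a' : Fin 4) : a ∉ (Finset.univ.erase a).erase a' := by
  simp

/-- The chart letters are not passive. [folklore] -/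
theorem not_mem_passive_right (a a' : Fin 4) : a' ∉ (Finset.univ.erase a).erase a' := by
  simp

/-- **`T_a` on numerators**: after the move in chart `a` the active pair `(f_a, f_{a′})` reads
`(f_a + f_{a′} − n, f_{a′})` with `n = d − |f|_P` the LEVEL (for `|f|_P ≤ d`), the passive degree being kept.
[cite: CossartJannsenSaito2020, Lemma 13.2] -/
theorem update_apply_chart {a a' : Fin 4} (h : a ≠ a') (f : Fin 4 →₀ ℕ) {d : ℕ}
    (hP : degIn ((Finset.univ.erase a).erase a') f ≤ d) :
    (f.update a (f.degree - d)) a = f a + f a' - (d - degIn ((Finset.univ.erase a).erase a') f) := by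
  rw [Finsupp.update_apply, if_pos rfl, degree_eq_apply_add_apply_add_degIn h f]
  omega

/-- The other active letter is untouched by the move in chart `a`. [folklore] -/
theorem update_apply_other {a a' : Fin 4} (h : a ≠ a') (f : Fin 4 →₀ ℕ) (v : ℕ) :
    (f.update a v) a' = f a' := by
  rw [Finsupp.update_apply, if_neg h.symm]

/-- The same two facts for the move in chart `a′` (the roles of the two active letters swapped): the pair
becomes `(f_a, f_a + f_{a′} − n)` = `T_b`. [cite: CossartJannsenSaito2020, Lemma 13.4] -/
theorem update_apply_chart' {a a' : Fin 4} (h : a ≠ a') (f : Fin 4 →₀ ℕ) {d : ℕ}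
    (hP : degIn ((Finset.univ.erase a).erase a') f ≤ d) :
    (f.update a' (f.degree - d)) a' = f a + f a' - (d - degIn ((Finset.univ.erase a).erase a') f) := by
  rw [Finsupp.update_apply, if_pos rfl, degree_eq_apply_add_apply_add_degIn h f]
  omega

/-- The passive degree of the moved exponent, in either chart of the active pair. [folklore] -/
theorem degIn_passive_update {a a' j : Fin 4} (hj : j = a ∨ j = a') (f : Fin 4 →₀ ℕ) (v : ℕ) :
    degIn ((Finset.univ.erase a).erase a') (f.update j v) = degIn ((Finset.univ.erase a).erase a') f := by
  rcases hj with rfl | rfl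
  · exact degIn_update_of_not_mem (not_mem_passive_left j a') f v
  · exact degIn_update_of_not_mem (not_mem_passive_right a j) f v

end ResCone

end Summit.ResolutionOfSingularities.ResolutionOfSingularities.Theorems.PIDim4

end
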